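import Literature.Probability.RandomPlanarGeometry.HullSubordination
import Mathlib.Analysis.Complex.AbsMax
import HarnessLib

/-!
# Subadditivity of `1 − Φ'_A(0)` over unions of `*`-hulls

G. F. Lawler, O. Schramm, W. Werner, *Conformal restriction: the chordal case*, J. Amer. Math.
Soc. **16** (2003) 917–955, arXiv:math/0209343 (**[LSW]**), §4, Prop. 4.1 (p. 12 of the arXiv
version): for `A ∈ 𝒬*`, `Φ'_A(0)` is the probability that a Brownian excursion in `ℍ` from `0`
avoids `A` ("By Proposition 4.1, this probability is the same as `1 − Φ_{A_t}'(W_t)`", proof of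
Lemma 6.3). For two `*`-hulls `B₁, B₂` with `B₁ ∪ B₂ = B ∈ 𝒬*` the union bound for the
excursion then reads

  `1 − Φ'_B(0) ≤ (1 − Φ'_{B₁}(0)) + (1 − Φ'_{B₂}(0))`.

This file gives a self-contained ANALYTIC proof of this inequality
(`Literature.Probability.RandomPlanarGeometry.HasRestrictionDeriv.one_sub_le_add`), with no Brownian excursions: the function
`v = im z − im Φ_{B₁} − im Φ_{B₂} + im Φ_B`, the imaginary part of the holomorphic function
`F = z − Φ_{B₁} − Φ_{B₂} + Φ_B` on `ℍ ∖ B`, has nonnegative boundary values in the limit sense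
(at a boundary point lying on `∂(ℍ ∖ B₁)` the terms `im Φ_B`, `im Φ_{B₁}` tend to `0` while
`im z − im Φ_{B₂} ≥ 0` by Julia's lemma `im Φ_{B₂} ≤ im`, `IsRestrictionMap.im_le_im`; at `∞`
all of `Φ_·(z) − z` have real limits), so `v ≥ 0` by the maximum principle applied to
`exp(iF)`; and `v(iy)/y → 1 − Φ'_{B₁}(0) − Φ'_{B₂}(0) + Φ'_B(0)` as `y ↘ 0`. It is used in
`SLERestrictionSlidHull` to obtain the lim-sup part of [LSW] Thm. 6.1 for two-sided hulls from
[LSW] Lemma 6.2 applied to the two side parts.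

Contents (all PROVED, no new definitions):

* `Literature.Probability.RandomPlanarGeometry.norm_le_of_frontier_of_cocompact` — a maximum modulus principle on an unbounded open
  connected set with boundary values in the lim-sup sense (at finite boundary points and at
  `∞`), from Mathlib's `Complex.norm_eqOn_of_isPreconnected_of_isMaxOn`;
* `Literature.Probability.RandomPlanarGeometry.ConformalEquiv.tendsto_im_nhdsWithin_frontier` — boundary points go to the boundary:
  for a conformal `Φ : ℍ ∖ A → ℍ` whose inverse tends to `∞` at `∞`, `im Φ(z) → 0` as `z`
  tends inside `ℍ ∖ A` to any finite boundary point;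
* `Literature.Probability.RandomPlanarGeometry.IsStarHull.exists_isRestrictionMap_tendsto_sub` — every `*`-hull has a restriction map
  `Φ_A` with `Φ_A⁻¹ → ∞` at `∞` and `Φ_A(z) − z → L ∈ ℝ` at `∞` (from the constructions of
  `HullUniformizer` / `RestrictionMapProofs`);
* `Literature.Probability.RandomPlanarGeometry.HasRestrictionDeriv.one_sub_le_add` — the subadditivity, for arbitrary restriction data
  of `B₁`, `B₂`, `B = B₁ ∪ B₂` (uniqueness of restriction maps, `IsRestrictionMap.unique`).
-/

noncomputable section

open Set Filter Topology Metric Bornology Complex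
open UpperHalfPlane (upperHalfPlaneSet isOpen_upperHalfPlaneSet)

namespace Literature.Probability.RandomPlanarGeometry

/-! ### A maximum modulus principle with boundary values in the lim-sup sense -/

/-- **Maximum modulus principle, lim-sup form.** Let `f` be holomorphic on an unbounded open
preconnected `U ⊆ ℂ`. If `lim sup ‖f‖ ≤ M` at every finite boundary point of `U` (approached
from inside `U`) and at `∞` inside `U`, then `‖f‖ ≤ M` on `U`. Proof: for `ε > 0` the set
`{z ∈ U : ‖f z‖ ≥ M + ε}` is compact (it is kept away from `∂U` and from `∞` by the
hypotheses with `ε/2`), so if nonempty `‖f‖` attains a maximum over `U` on it, and is then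
constant on `U` (`Complex.norm_eqOn_of_isPreconnected_of_isMaxOn`), contradicting the bound
`M + ε/2` far out. [folklore] -/
theorem norm_le_of_frontier_of_cocompact {U : Set ℂ} (hUo : IsOpen U) (hUc : IsPreconnected U)
    (hUb : ¬ IsBounded U) {f : ℂ → ℂ} (hf : DifferentiableOn ℂ f U) {M : ℝ}
    (hbdry : ∀ ζ ∈ frontier U, ∀ ε : ℝ, 0 < ε → ∀ᶠ z in 𝓝[U] ζ, ‖f z‖ ≤ M + ε)
    (hinf : ∀ ε : ℝ, 0 < ε → ∀ᶠ z in cocompact ℂ ⊓ 𝓟 U, ‖f z‖ ≤ M + ε) :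
    ∀ z ∈ U, ‖f z‖ ≤ M := by
  intro z₀ hz₀
  refine le_of_forall_pos_le_add fun ε hε ↦ ?_
  by_contra hlt
  push Not at hlt
  have hε2 : (0 : ℝ) < ε / 2 := by linarith
  -- far out, `‖f‖ ≤ M + ε/2`
  obtain ⟨C, hC, hCU⟩ : ∃ C : Set ℂ, IsCompact C ∧ ∀ z ∈ U, z ∉ C → ‖f z‖ ≤ M + ε / 2 := by
    have h := hinf (ε / 2) hε2
    rw [Filter.eventually_inf_principal] at h
    obtain ⟨C, hC, hsub⟩ := Filter.hasBasis_cocompact.eventually_iff.1 h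
    exact ⟨C, hC, fun z hz hzC ↦ hsub hzC hz⟩
  -- the set where `‖f‖ ≥ M + ε`
  set T : Set ℂ := {z | z ∈ U ∧ M + ε ≤ ‖f z‖} with hT
  have hz₀T : z₀ ∈ T := ⟨hz₀, hlt.le⟩
  have hTC : T ⊆ C := fun z hz ↦ by
    by_contra hzC
    linarith [hCU z hz.1 hzC, hz.2]
  have hTU : T ⊆ U := fun z hz ↦ hz.1
  have hTcl : IsClosed T := by
    refine isClosed_of_closure_subset fun t ht ↦ ?_
    haveI : (𝓝[T] t).NeBot := mem_closure_iff_nhdsWithin_neBot.1 ht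
    by_cases htU : t ∈ U
    · refine ⟨htU, ?_⟩
      have hcont : Tendsto (fun z ↦ ‖f z‖) (𝓝[T] t) (𝓝 ‖f t‖) :=
        ((hf.continuousOn.continuousAt (hUo.mem_nhds htU)).norm.tendsto).mono_left
          nhdsWithin_le_nhds
      exact ge_of_tendsto hcont (eventually_nhdsWithin_of_forall fun z hz ↦ hz.2)
    · exfalso
      have htfr : t ∈ frontier U := ⟨closure_mono hTU ht, fun h ↦ htU (interior_subset h)⟩
      have h1 : ∀ᶠ z in 𝓝[T] t, ‖f z‖ ≤ M + ε / 2 :=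
        (hbdry t htfr (ε / 2) hε2).filter_mono (nhdsWithin_mono _ hTU)
      have h2 : ∀ᶠ z in 𝓝[T] t, M + ε ≤ ‖f z‖ := eventually_nhdsWithin_of_forall fun z hz ↦ hz.2
      obtain ⟨z, hz1, hz2⟩ := (h1.and h2).exists
      linarith
  have hTcpt : IsCompact T := hC.of_isClosed_subset hTcl hTC
  -- `‖f‖` attains its maximum over `T`, hence over `U`, at some `c ∈ T`
  obtain ⟨c, hcT, hcmax⟩ := hTcpt.exists_isMaxOn ⟨z₀, hz₀T⟩ (hf.continuousOn.norm.mono hTU)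
  have hmaxU : IsMaxOn (norm ∘ f) U c := by
    intro z hz
    by_cases hzT : z ∈ T
    · exact hcmax hzT
    · have : ‖f z‖ < M + ε := by
        by_contra h
        exact hzT ⟨hz, not_lt.1 h⟩
      show ‖f z‖ ≤ ‖f c‖
      linarith [hcT.2]
  have heq := Complex.norm_eqOn_of_isPreconnected_of_isMaxOn hUc hUo hf hcT.1 hmaxU
  -- but `U` leaves the compact `C`, where `‖f‖ ≤ M + ε/2 < ‖f c‖`
  obtain ⟨z, hzU, hzC⟩ : ∃ z ∈ U, z ∉ C := by
    by_contra h
    push Not at h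
    exact hUb (hC.isBounded.subset h)
  have h1 := hCU z hzU hzC
  have h2 : ‖f z‖ = ‖f c‖ := heq hzU
  linarith [hcT.2]

/-! ### Boundary points go to the boundary -/

/-- **`im Φ → 0` at finite boundary points.** Let `Φ : ℍ ∖ A → ℍ` be a conformal equivalence
(`A` closed) whose inverse tends to `∞` at `∞`. Then `im Φ(z) → 0` as `z → ζ` inside `ℍ ∖ A`,
for every finite boundary point `ζ` of `ℍ ∖ A`: otherwise some `z_n → ζ` have
`Φ(z_n) → w ∈ ℍ` (the values `Φ(z_n)` are bounded, `Φ⁻¹ → ∞` at `∞`), and then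
`z_n = Φ⁻¹(Φ(z_n)) → Φ⁻¹(w) ∈ ℍ ∖ A`, an interior point. [folklore] -/
theorem ConformalEquiv.tendsto_im_nhdsWithin_frontier {A : Set ℂ}
    (Φ : ConformalEquiv (upperHalfPlaneSet \ A) upperHalfPlaneSet) (hA : IsClosed A)
    (hinf : Tendsto Φ.symm (cocompact ℂ ⊓ 𝓟 upperHalfPlaneSet) (cocompact ℂ))
    {ζ : ℂ} (hζ : ζ ∈ frontier (upperHalfPlaneSet \ A)) :
    Tendsto (fun z ↦ (Φ z).im) (𝓝[upperHalfPlaneSet \ A] ζ) (𝓝 0) := by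
  have hUo : IsOpen (upperHalfPlaneSet \ A) := isOpen_upperHalfPlaneSet.sdiff hA
  have hζU : ζ ∉ upperHalfPlaneSet \ A := fun h ↦ hζ.2 (by rw [hUo.interior_eq]; exact h)
  obtain ⟨Mb, hMb⟩ := exists_forall_norm_apply_le_of_tendsto_symm_cocompact hinf (‖ζ‖ + 1)
  rw [Metric.tendsto_nhds]
  intro ε hε
  by_contra hnot
  -- frequently `im Φ z ≥ ε` near `ζ`, at points of `ℍ ∖ A` of norm `≤ ‖ζ‖ + 1`
  have hball : ∀ᶠ z in 𝓝 ζ, ‖z‖ ≤ ‖ζ‖ + 1 := by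
    filter_upwards [Metric.ball_mem_nhds ζ one_pos] with z hz
    rw [mem_ball, dist_eq_norm] at hz
    linarith [norm_sub_norm_le z ζ]
  have hnear : ∀ᶠ z in 𝓝[upperHalfPlaneSet \ A] ζ, z ∈ upperHalfPlaneSet \ A ∧ ‖z‖ ≤ ‖ζ‖ + 1 := by
    filter_upwards [self_mem_nhdsWithin, mem_nhdsWithin_of_mem_nhds hball] with z hzU hz
    exact ⟨hzU, hz⟩
  have hfreq : ∃ᶠ z in 𝓝[upperHalfPlaneSet \ A] ζ,
      ε ≤ (Φ z).im ∧ z ∈ upperHalfPlaneSet \ A ∧ ‖z‖ ≤ ‖ζ‖ + 1 := by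
    have h1 : ∃ᶠ z in 𝓝[upperHalfPlaneSet \ A] ζ, ¬ dist (Φ z).im 0 < ε :=
      Filter.not_eventually.1 hnot
    refine (h1.and_eventually hnear).mono fun z hz ↦ ⟨?_, hz.2⟩
    have him : 0 < (Φ z).im := Φ.mapsTo hz.2.1
    have := hz.1
    rw [Real.dist_0_eq_abs, abs_of_pos him, not_lt] at this
    exact this
  obtain ⟨s, hs, hsP⟩ := Filter.exists_seq_forall_of_frequently hfreq
  -- the values `Φ (s n)` lie in a compact subset of `ℍ`
  set K : Set ℂ := {w | ε ≤ w.im ∧ ‖w‖ ≤ Mb} with hK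
  have hKc : IsCompact K := by
    refine (isCompact_closedBall (0 : ℂ) Mb).of_isClosed_subset ?_ fun w hw ↦ ?_
    · exact (isClosed_le continuous_const Complex.continuous_im).inter
        (isClosed_le continuous_norm continuous_const)
    · simpa using hw.2
  have hsK : ∀ n, Φ (s n) ∈ K := fun n ↦ ⟨(hsP n).1, hMb _ (hsP n).2.1 (hsP n).2.2⟩
  obtain ⟨w, hwK, φ, hφ, hlim⟩ := hKc.tendsto_subseq hsK
  have hwH : w ∈ upperHalfPlaneSet := show 0 < w.im from lt_of_lt_of_le hε hwK.1
  -- `s (φ n) = Φ⁻¹ (Φ (s (φ n))) → Φ⁻¹ w ∈ ℍ ∖ A`, but also `→ ζ ∉ ℍ ∖ A`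
  have h1 : Tendsto (fun n ↦ s (φ n)) atTop (𝓝 (Φ.symm w)) := by
    have hc : ContinuousAt Φ.symm w :=
      (Φ.symm.differentiableOn_coe.differentiableAt (isOpen_upperHalfPlaneSet.mem_nhds hwH)).continuousAt
    refine (hc.tendsto.comp hlim).congr fun n ↦ ?_
    simp only [Function.comp_apply]
    exact Φ.symm_apply_apply (hsP (φ n)).2.1
  have h2 : Tendsto (fun n ↦ s (φ n)) atTop (𝓝 ζ) :=
    (hs.comp hφ.tendsto_atTop).mono_right nhdsWithin_le_nhds
  have heq : Φ.symm w = ζ := tendsto_nhds_unique h1 h2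
  exact hζU (heq ▸ Φ.symm_mapsTo hwH)

/-! ### Restriction maps with `Φ_A(z) − z → L` at `∞` -/

/-- For a one-sided hull with slit data, the restriction map of `HullUniformizer` has
`Φ⁻¹ → ∞` at `∞` and `Φ(z) − z → L ∈ ℝ` at `∞`. [folklore] -/
theorem IsSlitHull.exists_isRestrictionMap_tendsto_sub {A : Set ℂ} {p q : ℝ} (h : IsSlitHull A p q) :
    ∃ Φ : ConformalEquiv (upperHalfPlaneSet \ A) upperHalfPlaneSet, IsRestrictionMap A Φ ∧
      Tendsto Φ.symm (cocompact ℂ ⊓ 𝓟 upperHalfPlaneSet) (cocompact ℂ) ∧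
      ∃ L : ℝ, Tendsto (fun z ↦ Φ z - z) (cocompact ℂ ⊓ 𝓟 (upperHalfPlaneSet \ A)) (𝓝 (L : ℂ)) := by
  obtain ⟨L, hL⟩ := h.exists_tendsto_ext_sub
  exact ⟨h.restrictionMap, h.isRestrictionMap, h.tendsto_symm_cocompact, L,
    (hL.mono_left inf_le_left).congr fun z ↦ by rw [h.restrictionMap_apply]⟩

/-- **Every `*`-hull has a restriction map `Φ_A` with `Φ_A⁻¹ → ∞` at `∞` and
`Φ_A(z) − z → L ∈ ℝ` at `∞`** (by cases as in `IsStarHull.exists_restrictionMap_tendsto`: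
`Φ_∅ = id`; one-sided hulls by `HullUniformizer`; two-sided hulls by `Φ_A = Φ_B ∘ E₋`,
`RestrictionMapProofs`, where both factors have such limits). In [LSW]'s terms
`Φ_A(z) − z = (g_A(z) − z) − g_A(0) → −g_A(0)` (§2 p. 7, "`g_A(z) − z → 0` as `z → ∞`").
[cite: LawlerSchrammWerner2003Restriction, §2 pp. 7–8 (g_A, Φ_A = g_A − g_A(0))] -/
theorem IsStarHull.exists_isRestrictionMap_tendsto_sub {A : Set ℂ} (hA : IsStarHull A) :
    ∃ Φ : ConformalEquiv (upperHalfPlaneSet \ A) upperHalfPlaneSet, IsRestrictionMap A Φ ∧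
      Tendsto Φ.symm (cocompact ℂ ⊓ 𝓟 upperHalfPlaneSet) (cocompact ℂ) ∧
      ∃ L : ℝ, Tendsto (fun z ↦ Φ z - z) (cocompact ℂ ⊓ 𝓟 (upperHalfPlaneSet \ A)) (𝓝 (L : ℂ)) := by
  by_cases hne : (sidePart A (-1)).Nonempty
  · by_cases hne' : (sidePart A 1).Nonempty
    · -- two-sided: `Φ_A = E_B ∘ E₋`
      have hm := hA.minusSlit hne
      have hB := hA.plusSlit hne hne'
      obtain ⟨Lm, hLm⟩ := hm.exists_tendsto_ext_sub
      obtain ⟨LB, hLB⟩ := hB.exists_tendsto_ext_sub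
      refine ⟨hA.twoSidedMap hne hne', hA.isRestrictionMap_twoSidedMap hne hne',
        hA.tendsto_twoSidedMap_symm_cocompact hne hne', LB + Lm, ?_⟩
      have h1 : Tendsto (fun z ↦ hB.ext (hm.ext z) - hm.ext z)
          (cocompact ℂ ⊓ 𝓟 (upperHalfPlaneSet \ A)) (𝓝 (LB : ℂ)) :=
        hLB.comp ((hA.tendsto_ext_cocompact hne).mono_right inf_le_left)
      have h2 : Tendsto (fun z ↦ hm.ext z - z) (cocompact ℂ ⊓ 𝓟 (upperHalfPlaneSet \ A))
          (𝓝 (Lm : ℂ)) :=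
        hLm.mono_left inf_le_left
      have := h1.add h2
      rw [← ofReal_add] at this
      refine this.congr fun z ↦ ?_
      rw [hA.twoSidedMap_apply hne hne']
      ring
    · -- `A = A₋` is a nonempty `−`-hull
      have heq : sidePart A (-1) = A := by
        have h1 := hA.plusPart_union_minusPart
        rwa [not_nonempty_iff_eq_empty.1 hne', empty_union] at h1
      have h := hA.minusSlit hne
      rw [heq] at h
      exact h.exists_isRestrictionMap_tendsto_sub
  · have heq : sidePart A 1 = A := by
      have h1 := hA.plusPart_union_minusPart
      rwa [not_nonempty_iff_eq_empty.1 hne, union_empty] at h1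
    by_cases hAne : A.Nonempty
    · have hplus : IsPlusHull A := heq ▸ hA.isPlusHull_plusPart
      exact (hplus.isSlitHull hAne).exists_isRestrictionMap_tendsto_sub
    · rw [not_nonempty_iff_eq_empty] at hAne
      subst hAne
      refine ⟨restrictionMapEmpty, isRestrictionMap_empty, ?_, 0, ?_⟩
      · have : ∀ w, restrictionMapEmpty.symm w = w := fun w ↦ rfl
        exact (tendsto_id.mono_left inf_le_left).congr fun w ↦ (this w).symm
      · simp only [restrictionMapEmpty_apply, sub_self, ofReal_zero]
        exact tendsto_const_nhds

/-! ### The subadditivity inequality -/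

section Core

variable {B₁ B₂ B : Set ℂ}
  {Φ₁ : ConformalEquiv (upperHalfPlaneSet \ B₁) upperHalfPlaneSet}
  {Φ₂ : ConformalEquiv (upperHalfPlaneSet \ B₂) upperHalfPlaneSet}
  {Φ : ConformalEquiv (upperHalfPlaneSet \ B) upperHalfPlaneSet}

/-- `im w / y = re (w / (iy))` for real `y` (both sides vanish for `y = 0`). [folklore] -/
theorem im_div_eq_re_div_I_mul (w : ℂ) (y : ℝ) : w.im / y = (w / (I * y)).re := by
  rw [div_mul_eq_div_div, div_I, neg_div, neg_re, div_ofReal_re, mul_re, I_re, I_im]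
  ring

/-- The points `iy`, `y ↘ 0`, tend to `0` inside `ℍ ∖ B` for a `*`-hull `B`. [folklore] -/
theorem IsStarHull.tendsto_I_mul_nhdsWithin_zero (hB : IsStarHull B) :
    Tendsto (fun y : ℝ ↦ I * y) (𝓝[>] 0) (𝓝[upperHalfPlaneSet \ B] 0) := by
  obtain ⟨ε, hε, hball⟩ := hB.exists_ball_subset
  refine tendsto_nhdsWithin_iff.2 ⟨?_, ?_⟩
  · have : Tendsto (fun y : ℝ ↦ I * (y : ℂ)) (𝓝 0) (𝓝 (I * (0 : ℝ))) :=
      (continuous_const.mul continuous_ofReal).tendsto 0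
    simpa using this.mono_left nhdsWithin_le_nhds
  · have hy : ∀ᶠ y : ℝ in 𝓝[>] 0, y ∈ Ioo 0 ε := Ioo_mem_nhdsGT hε
    filter_upwards [hy] with y hy
    refine hball ⟨?_, ?_⟩
    · rw [mem_ball, dist_zero_right, norm_mul, norm_I, one_mul, norm_real, Real.norm_eq_abs,
        abs_of_pos hy.1]
      exact hy.2
    · show 0 < (I * y).im
      simpa using hy.1

/-- `im Φ(iy) / y → Φ'(0)` as `y ↘ 0`, from `HasRestrictionDeriv`. [folklore] -/
theorem HasRestrictionDeriv.tendsto_im_div {A : Set ℂ} (hA : IsStarHull A)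
    {Ψ : ConformalEquiv (upperHalfPlaneSet \ A) upperHalfPlaneSet} {d : ℝ}
    (hd : HasRestrictionDeriv A Ψ d) :
    Tendsto (fun y : ℝ ↦ (Ψ (I * y)).im / y) (𝓝[>] 0) (𝓝 d) := by
  have h1 : Tendsto (fun y : ℝ ↦ (Ψ (I * y) / (I * y)).re) (𝓝[>] 0) (𝓝 (d : ℂ).re) :=
    (continuous_re.tendsto _).comp (hd.comp hA.tendsto_I_mul_nhdsWithin_zero)
  rw [ofReal_re] at h1
  exact h1.congr fun y ↦ (im_div_eq_re_div_I_mul _ y).symm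

/-- **Core of the subadditivity**: `Φ'_{B₁}(0) + Φ'_{B₂}(0) ≤ 1 + Φ'_B(0)` for `*`-hulls
`B₁ ∪ B₂ = B`, for restriction maps whose inverses tend to `∞` at `∞` and with real limits
`Φ_·(z) − z → L_·` at `∞`. The holomorphic function `F = z − Φ₁ − Φ₂ + Φ` on `ℍ ∖ B` has
`im F ≥ 0` in the lim-inf sense at every finite boundary point (boundary points of `ℍ ∖ B`
are boundary points of `ℍ ∖ B₁` or of `ℍ ∖ B₂`, where `im Φ₁`, resp. `im Φ₂`, and `im Φ`
tend to `0`, the remaining terms being `≥ 0` in the limit by `im Φ_· ≤ im`) and at `∞`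
(where `im F → 0`); the maximum principle for `exp(iF)` gives `im F ≥ 0`, and along `iy`,
`y ↘ 0`, `im F(iy)/y → 1 − d₁ − d₂ + d`. [cite: LawlerSchrammWerner2003Restriction, Prop. 4.1 (Φ'_A(0) = P[excursion avoids A]; union bound), analytic proof] -/
theorem HasRestrictionDeriv.add_le_one_add_of_tendsto (hB₁ : IsStarHull B₁) (hB₂ : IsStarHull B₂)
    (hB : IsStarHull B) (hunion : B₁ ∪ B₂ = B)
    (hi₁ : Tendsto Φ₁.symm (cocompact ℂ ⊓ 𝓟 upperHalfPlaneSet) (cocompact ℂ))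
    (hi₂ : Tendsto Φ₂.symm (cocompact ℂ ⊓ 𝓟 upperHalfPlaneSet) (cocompact ℂ))
    (hi : Tendsto Φ.symm (cocompact ℂ ⊓ 𝓟 upperHalfPlaneSet) (cocompact ℂ))
    (hΦ₁ : IsRestrictionMap B₁ Φ₁) (hΦ₂ : IsRestrictionMap B₂ Φ₂)
    {L₁ L₂ L : ℝ}
    (hL₁ : Tendsto (fun z ↦ Φ₁ z - z) (cocompact ℂ ⊓ 𝓟 (upperHalfPlaneSet \ B₁)) (𝓝 (L₁ : ℂ)))
    (hL₂ : Tendsto (fun z ↦ Φ₂ z - z) (cocompact ℂ ⊓ 𝓟 (upperHalfPlaneSet \ B₂)) (𝓝 (L₂ : ℂ)))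
    (hL : Tendsto (fun z ↦ Φ z - z) (cocompact ℂ ⊓ 𝓟 (upperHalfPlaneSet \ B)) (𝓝 (L : ℂ)))
    {d₁ d₂ d : ℝ} (hd₁ : HasRestrictionDeriv B₁ Φ₁ d₁) (hd₂ : HasRestrictionDeriv B₂ Φ₂ d₂)
    (hd : HasRestrictionDeriv B Φ d) :
    d₁ + d₂ ≤ 1 + d := by
  have hsub₁ : upperHalfPlaneSet \ B ⊆ upperHalfPlaneSet \ B₁ := fun z hz ↦
    ⟨hz.1, fun h ↦ hz.2 (by rw [← hunion]; exact Or.inl h)⟩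
  have hsub₂ : upperHalfPlaneSet \ B ⊆ upperHalfPlaneSet \ B₂ := fun z hz ↦
    ⟨hz.1, fun h ↦ hz.2 (by rw [← hunion]; exact Or.inr h)⟩
  have hUo : IsOpen (upperHalfPlaneSet \ B) := hB.isBoundedHull.isOpen_diff
  have hUc : IsPreconnected (upperHalfPlaneSet \ B) := hB.isBoundedHull.isPreconnected_diff
  have hUb : ¬ IsBounded (upperHalfPlaneSet \ B) := by
    intro hb
    obtain ⟨R, hR, hfar⟩ := hB.isBoundedHull.exists_radius
    obtain ⟨r, hr⟩ := hb.subset_ball 0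
    set t : ℝ := max r R + 1 with ht
    have ht0 : 0 < t := by rw [ht]; linarith [le_max_right r R]
    have hnorm : ‖I * (t : ℂ)‖ = t := by
      rw [norm_mul, norm_I, one_mul, norm_real, Real.norm_eq_abs, abs_of_pos ht0]
    have hmem : I * (t : ℂ) ∈ upperHalfPlaneSet \ B :=
      hfar _ (show 0 < (I * (t : ℂ)).im by simpa using ht0)
        (by rw [hnorm, ht]; linarith [le_max_right r R])
    have := hr hmem
    rw [mem_ball_zero_iff, hnorm, ht] at this
    linarith [le_max_left r R]
  -- the functions `F = z − Φ₁ − Φ₂ + Φ`, `v = im F`, `g = exp(iF)`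
  set F : ℂ → ℂ := fun z ↦ z - Φ₁ z - Φ₂ z + Φ z with hF
  set g : ℂ → ℂ := fun z ↦ exp (I * F z) with hg
  have hnorm_g : ∀ z, ‖g z‖ = Real.exp (-(F z).im) := fun z ↦ by
    rw [hg]
    simp only [norm_exp, mul_re, I_re, zero_mul, I_im, one_mul, zero_sub]
  have hFd : DifferentiableOn ℂ F (upperHalfPlaneSet \ B) :=
    ((differentiableOn_id.sub (Φ₁.differentiableOn_coe.mono hsub₁)).sub
      (Φ₂.differentiableOn_coe.mono hsub₂)).add Φ.differentiableOn_coe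
  have hgd : DifferentiableOn ℂ g (upperHalfPlaneSet \ B) := ((differentiableOn_const I).mul hFd).cexp
  -- from `lim inf im F ≥ 0` to `lim sup ‖g‖ ≤ 1`
  have key : ∀ {l : Filter ℂ} {c : ℝ}, 0 ≤ c → Tendsto (fun z ↦ (F z).im) l (𝓝 c) →
      ∀ ε : ℝ, 0 < ε → ∀ᶠ z in l, ‖g z‖ ≤ 1 + ε := by
    intro l c hc hten ε hε
    have hη : 0 < Real.log (1 + ε) := Real.log_pos (by linarith)
    have hev : ∀ᶠ z in l, c - Real.log (1 + ε) < (F z).im :=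
      hten.eventually (Ioi_mem_nhds (by linarith))
    filter_upwards [hev] with z hz
    rw [hnorm_g]
    calc Real.exp (-(F z).im) ≤ Real.exp (Real.log (1 + ε)) := Real.exp_le_exp.2 (by linarith)
      _ = 1 + ε := Real.exp_log (by linarith)
  -- boundary behaviour at finite boundary points
  have hbdry : ∀ ζ ∈ frontier (upperHalfPlaneSet \ B), ∀ ε : ℝ, 0 < ε →
      ∀ᶠ z in 𝓝[upperHalfPlaneSet \ B] ζ, ‖g z‖ ≤ 1 + ε := by
    intro ζ hζ
    have hζU : ζ ∉ upperHalfPlaneSet \ B := fun h ↦ hζ.2 (by rw [hUo.interior_eq]; exact h)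
    have hζcl : ζ ∈ closure (upperHalfPlaneSet \ B) := frontier_subset_closure hζ
    have hζim : 0 ≤ ζ.im := by
      have : closure (upperHalfPlaneSet \ B) ⊆ {z : ℂ | 0 ≤ z.im} := by
        rw [← closure_setOf_lt_im]
        exact closure_mono fun z hz ↦ hz.1
      exact this hζcl
    -- `im Φ z → 0`
    have hΦ0 : Tendsto (fun z ↦ (Φ z).im) (𝓝[upperHalfPlaneSet \ B] ζ) (𝓝 0) :=
      Φ.tendsto_im_nhdsWithin_frontier hB.isBoundedHull.isClosed hi hζ
    -- `im z → im ζ`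
    have hz0 : Tendsto (fun z : ℂ ↦ z.im) (𝓝[upperHalfPlaneSet \ B] ζ) (𝓝 ζ.im) :=
      (continuous_im.tendsto ζ).mono_left nhdsWithin_le_nhds
    -- dichotomy for `Φ₁`, `Φ₂`: interior point or boundary point
    have dich : ∀ {B' : Set ℂ} (_ : IsStarHull B') (_ : upperHalfPlaneSet \ B ⊆ upperHalfPlaneSet \ B')
        (Ψ : ConformalEquiv (upperHalfPlaneSet \ B') upperHalfPlaneSet)
        (_ : Tendsto Ψ.symm (cocompact ℂ ⊓ 𝓟 upperHalfPlaneSet) (cocompact ℂ))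
        (_ : IsRestrictionMap B' Ψ),
        ∃ ℓ : ℝ, ℓ ≤ ζ.im ∧ (ζ ∉ upperHalfPlaneSet \ B' → ℓ = 0) ∧
          Tendsto (fun z ↦ (Ψ z).im) (𝓝[upperHalfPlaneSet \ B] ζ) (𝓝 ℓ) := by
      intro B' hB' hsub' Ψ hiΨ hΨ
      have hζcl' : ζ ∈ closure (upperHalfPlaneSet \ B') := closure_mono hsub' hζcl
      rw [closure_eq_self_union_frontier] at hζcl'
      by_cases hζ' : ζ ∈ upperHalfPlaneSet \ B'
      · -- interior point: continuity, and `im Ψ ζ ≤ im ζ`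
        refine ⟨(Ψ ζ).im, hΨ.im_le_im hB'.isBoundedHull.1 hζ', fun h ↦ absurd hζ' h, ?_⟩
        have hc : ContinuousAt Ψ ζ :=
          (Ψ.differentiableOn_coe.differentiableAt
            (hB'.isBoundedHull.isOpen_diff.mem_nhds hζ')).continuousAt
        exact ((continuous_im.tendsto _).comp hc.tendsto).mono_left nhdsWithin_le_nhds
      · have hfr : ζ ∈ frontier (upperHalfPlaneSet \ B') := hζcl'.resolve_left hζ'
        refine ⟨0, hζim, fun _ ↦ rfl, ?_⟩
        exact (Ψ.tendsto_im_nhdsWithin_frontier hB'.isBoundedHull.isClosed hiΨ hfr).mono_left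
          (nhdsWithin_mono _ hsub')
    obtain ⟨ℓ₁, hℓ₁le, hℓ₁0, hT₁⟩ := dich hB₁ hsub₁ Φ₁ hi₁ hΦ₁
    obtain ⟨ℓ₂, hℓ₂le, hℓ₂0, hT₂⟩ := dich hB₂ hsub₂ Φ₂ hi₂ hΦ₂
    -- the limit of `im F` and its sign
    have hlim : Tendsto (fun z ↦ (F z).im) (𝓝[upperHalfPlaneSet \ B] ζ) (𝓝 (ζ.im - ℓ₁ - ℓ₂ + 0)) := by
      have := ((hz0.sub hT₁).sub hT₂).add hΦ0
      refine this.congr fun z ↦ ?_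
      simp only [hF, sub_im, add_im]
    have hc : 0 ≤ ζ.im - ℓ₁ - ℓ₂ + 0 := by
      -- `ζ` is not interior for both maps (else `ζ ∈ ℍ ∖ B`)
      by_cases h₁ : ζ ∈ upperHalfPlaneSet \ B₁
      · have h₂ : ζ ∉ upperHalfPlaneSet \ B₂ := by
          intro h₂
          refine hζU ⟨h₁.1, fun hζB ↦ ?_⟩
          rw [← hunion] at hζB
          rcases hζB with h | h
          · exact h₁.2 h
          · exact h₂.2 h
        rw [hℓ₂0 h₂]
        linarith
      · rw [hℓ₁0 h₁]
        linarith
    exact key hc hlim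
  -- behaviour at `∞`
  have hinf' : ∀ ε : ℝ, 0 < ε → ∀ᶠ z in cocompact ℂ ⊓ 𝓟 (upperHalfPlaneSet \ B), ‖g z‖ ≤ 1 + ε := by
    have h1 : Tendsto (fun z ↦ Φ₁ z - z) (cocompact ℂ ⊓ 𝓟 (upperHalfPlaneSet \ B)) (𝓝 (L₁ : ℂ)) :=
      hL₁.mono_left (inf_le_inf_left _ (principal_mono.2 hsub₁))
    have h2 : Tendsto (fun z ↦ Φ₂ z - z) (cocompact ℂ ⊓ 𝓟 (upperHalfPlaneSet \ B)) (𝓝 (L₂ : ℂ)) :=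
      hL₂.mono_left (inf_le_inf_left _ (principal_mono.2 hsub₂))
    have hsum : Tendsto (fun z ↦ ((Φ z - z) - (Φ₁ z - z) - (Φ₂ z - z)).im)
        (cocompact ℂ ⊓ 𝓟 (upperHalfPlaneSet \ B)) (𝓝 (((L : ℂ) - L₁ - L₂).im)) :=
      (continuous_im.tendsto _).comp ((hL.sub h1).sub h2)
    have him0 : ((L : ℂ) - L₁ - L₂).im = 0 := by simp
    rw [him0] at hsum
    have hlim : Tendsto (fun z ↦ (F z).im) (cocompact ℂ ⊓ 𝓟 (upperHalfPlaneSet \ B)) (𝓝 0) := by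
      refine hsum.congr fun z ↦ ?_
      simp only [hF, sub_im, add_im]
      ring
    exact key le_rfl hlim
  -- the maximum principle: `‖g‖ ≤ 1`, i.e. `im F ≥ 0` on `ℍ ∖ B`
  have hmax := norm_le_of_frontier_of_cocompact hUo hUc hUb hgd (M := 1)
    (fun ζ hζ ε hε ↦ hbdry ζ hζ ε hε) (fun ε hε ↦ hinf' ε hε)
  have hv : ∀ z ∈ upperHalfPlaneSet \ B, 0 ≤ (F z).im := fun z hz ↦ by
    have := hmax z hz
    rw [hnorm_g, Real.exp_le_one_iff] at this
    linarith
  -- along `iy`, `y ↘ 0`: `im F(iy) / y → 1 − d₁ − d₂ + d`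
  have hT := hB.tendsto_I_mul_nhdsWithin_zero
  have hev : ∀ᶠ y : ℝ in 𝓝[>] 0, I * (y : ℂ) ∈ upperHalfPlaneSet \ B :=
    hT.eventually self_mem_nhdsWithin
  have hlimy : Tendsto (fun y : ℝ ↦ (F (I * y)).im / y) (𝓝[>] 0) (𝓝 (1 - d₁ - d₂ + d)) := by
    have h1 := hd₁.tendsto_im_div hB₁
    have h2 := hd₂.tendsto_im_div hB₂
    have h3 := hd.tendsto_im_div hB
    have h0 : Tendsto (fun y : ℝ ↦ ((I * (y : ℂ)).im) / y) (𝓝[>] 0) (𝓝 1) := by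
      refine (tendsto_const_nhds (x := (1 : ℝ))).congr' ?_
      filter_upwards [self_mem_nhdsWithin] with y hy
      have hy0 : (y : ℝ) ≠ 0 := ne_of_gt hy
      simp [hy0]
    have := ((h0.sub h1).sub h2).add h3
    refine this.congr' (Eventually.of_forall fun y ↦ ?_)
    simp only [hF, sub_im, add_im]
    ring
  have hge : ∀ᶠ y : ℝ in 𝓝[>] 0, 0 ≤ (F (I * y)).im / y := by
    filter_upwards [hev, self_mem_nhdsWithin] with y hyU hy
    exact div_nonneg (hv _ hyU) (le_of_lt hy)
  have := ge_of_tendsto hlimy hge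
  linarith

end Core

/-- **Subadditivity of `1 − Φ'(0)` over unions of `*`-hulls**: for `*`-hulls `B₁, B₂` whose
union `B = B₁ ∪ B₂` is a `*`-hull, and any restriction data,
`1 − Φ'_B(0) ≤ (1 − Φ'_{B₁}(0)) + (1 − Φ'_{B₂}(0))`. In [LSW] this is the union bound for the
Brownian excursion behind Prop. 4.1 (`1 − Φ'_A(0) = P[excursion hits A]`); here it is proved
analytically (`add_le_one_add_of_tendsto`) for the restriction maps of
`IsStarHull.exists_isRestrictionMap_tendsto_sub` and transported to arbitrary restriction data
by the uniqueness of restriction maps (`IsRestrictionMap.unique`) and of `Φ'(0)`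
(`HasRestrictionDeriv.unique`). [cite: LawlerSchrammWerner2003Restriction, Prop. 4.1 (p. 12; excursion interpretation of Φ'_A(0)), analytic proof of the union bound] -/
theorem HasRestrictionDeriv.one_sub_le_add {B₁ B₂ B : Set ℂ} (hB₁ : IsStarHull B₁)
    (hB₂ : IsStarHull B₂) (hB : IsStarHull B) (hunion : B₁ ∪ B₂ = B)
    {Φ₁ : ConformalEquiv (upperHalfPlaneSet \ B₁) upperHalfPlaneSet}
    {Φ₂ : ConformalEquiv (upperHalfPlaneSet \ B₂) upperHalfPlaneSet}
    {Φ : ConformalEquiv (upperHalfPlaneSet \ B) upperHalfPlaneSet}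
    (hΦ₁ : IsRestrictionMap B₁ Φ₁) (hΦ₂ : IsRestrictionMap B₂ Φ₂) (hΦ : IsRestrictionMap B Φ)
    {d₁ d₂ d : ℝ} (hd₁ : HasRestrictionDeriv B₁ Φ₁ d₁) (hd₂ : HasRestrictionDeriv B₂ Φ₂ d₂)
    (hd : HasRestrictionDeriv B Φ d) :
    1 - d ≤ (1 - d₁) + (1 - d₂) := by
  -- nice maps and their derivatives
  obtain ⟨Ψ₁, hΨ₁, hi₁, L₁, hL₁⟩ := hB₁.exists_isRestrictionMap_tendsto_sub
  obtain ⟨Ψ₂, hΨ₂, hi₂, L₂, hL₂⟩ := hB₂.exists_isRestrictionMap_tendsto_sub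
  obtain ⟨Ψ, hΨ, hi, L, hL⟩ := hB.exists_isRestrictionMap_tendsto_sub
  obtain ⟨e₁, -, -, he₁⟩ := IsStarHull.exists_hasRestrictionDeriv_holds hB₁ hΨ₁
  obtain ⟨e₂, -, -, he₂⟩ := IsStarHull.exists_hasRestrictionDeriv_holds hB₂ hΨ₂
  obtain ⟨e, -, -, he⟩ := IsStarHull.exists_hasRestrictionDeriv_holds hB hΨ
  have hcore := HasRestrictionDeriv.add_le_one_add_of_tendsto hB₁ hB₂ hB hunion hi₁ hi₂ hi hΨ₁ hΨ₂
    hL₁ hL₂ hL he₁ he₂ he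
  -- the derivatives do not depend on the maps
  have transfer : ∀ {A : Set ℂ} (hA : IsStarHull A)
      {Θ Θ' : ConformalEquiv (upperHalfPlaneSet \ A) upperHalfPlaneSet}
      (hΘ : IsRestrictionMap A Θ) (hΘ' : IsRestrictionMap A Θ') {c c' : ℝ}
      (hc : HasRestrictionDeriv A Θ c) (hc' : HasRestrictionDeriv A Θ' c'), c = c' := by
    intro A hA Θ Θ' hΘ hΘ' c c' hc hc'
    have hEq : EqOn Θ Θ' (upperHalfPlaneSet \ A) := IsRestrictionMap.unique hA hΘ' hΘ
    have hc'' : HasRestrictionDeriv A Θ' c :=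
      (hc : Tendsto _ _ _).congr' (eventually_nhdsWithin_of_forall fun z hz ↦ by rw [hEq hz])
    exact hc''.unique hA hc'
  have h1 : d₁ = e₁ := transfer hB₁ hΦ₁ hΨ₁ hd₁ he₁
  have h2 : d₂ = e₂ := transfer hB₂ hΦ₂ hΨ₂ hd₂ he₂
  have h3 : d = e := transfer hB hΦ hΨ hd he
  subst h1 h2 h3
  linarith

end Literature.Probability.RandomPlanarGeometry

end
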